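import Summits.CriticalPhenomena.PercolationContinuityZ3.Theorems.PercNearOneGluingNoHeavyLowerTailCombRowsLeFive
import HarnessLib

/-!
# The three-point VARIANCE row `P(a↔b)·P(a↮b) ≤ P(exactly one link among a,b,c)` on every weighted graph with at most five vertices

Support file for crux `stmt-CriticalPhenomena-4575` (`NoHeavyLowerTail`), seat `prim-l12-p1` gen 15 (`--supports stmt-CriticalPhenomena-4575`;
COMPUTATIONAL: three `checkC` evaluations use `native_decide`).  Memo `run/shared/lean/prim/prim-l12/FROM-prim-l12-p1-g15-TERMWISE-ROW-AND-3PT.md`.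

Bond percolation `μ = prodBernoulli w` with arbitrary edge weights on `Fin n`, three distinct vertices `a b c`.  THE NEW ROW (conjectured for every finite
graph; it is the three-point shadow `c = y` of the termwise row `(**)` that implies the two-link deficit row `W0` of gen 12 and its siblings `V13, V15, V12`):

  `(3PT)   P(a↔b)·P(a↮b) ≤ P(a↔b, a↮c) + P(a↔c, a↮b) + P(b↔c, a↮b)`,

i.e. `Var(1_{a↔b}) ≤ P(exactly one of the three pairs is connected)`; equivalently `P(abc)·P(a|b|c) ≤ P(ab|c)·P(a↔b) + [P(ac|b)+P(a|bc)]·P(a↮b)`,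
a sharpening of Gladkov–Zimin's `P(abc)·P(a|b|c) ≤ P(exactly one link)` and a sibling of their Theorem 4.6
`P(a↮{b,c})·P(a↔{b,c}) ≤ P(exactly one link)` [cite: GladkovZimin2024, Thm. 4.6 and its proof (final display)].  Evidence for all `n` (memo §2): two-copy comb
positive on every multigraph fibre with `≤ 6` vertices and `≤ 10` edges (`≤ 3`-fold) and every simple fibre with `7` vertices and `≤ 10` edges; no law-level
violation under adversarial search.  THIS FILE proves it for every `n ≤ 5`, every weight vector and all pairwise distinct `a b c`, by prim-bnk-1's generic
packaging `CombRows.tri_cval_le_five`: the four-term family `varTerms` is relabelling-equivariant (`rfl`) and passes prim-cert-2's three-copy comb checker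
`checkC` at the standard triple of `K₃`, `K₄` and `K₅` (a quadratic row with `pTrue` third factors is three-copy comb positive iff two-copy comb positive).
Nothing is claimed here beyond five vertices.

Main results: `var_cval_le_five` (term form), `threePointVariance_le_five` (the displayed inequality in `openConn` notation).
-/

namespace Summit.CriticalPhenomena.PercolationContinuityZ3.Theorems.ThreePointVariance

open Finset MeasureTheory OneCutCert CovTransferCert E3GroupSepCert CombRows
open scoped BigOperators
open Literature.Probability.Percolation Literature.Probability.LatticeModels

variable {n : ℕ}

/-- The event `a ↔ b`. [this work] -/
def pAB (a b : Fin n) : CRel n → Bool := fun r => r a b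
/-- The event `a ↮ b`. [this work] -/
def pNAB (a b : Fin n) : CRel n → Bool := fun r => !(r a b)

/-- The four signed terms of `(3PT)` (right side minus left side; unused factors `pTrue`):
`P(ab|c)·1·1 + P(ac|b)·1·1 + P(bc, a↮b)·1·1 − P(a↔b)·P(a↮b)·1`. [this work] -/
def varTerms (n : ℕ) (t : Tri n) : List (CTerm n) :=
  let a := t.1
  let b := t.2.1
  let c := t.2.2
  [((1 : ℤ), pU₁ a b c, pTrue, pTrue), ((1 : ℤ), pU₂ a b c, pTrue, pTrue), ((1 : ℤ), pU₃ a b c, pTrue, pTrue),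
    ((-1 : ℤ), pAB a b, pNAB a b, pTrue)]

/-- The family commutes with vertex relabellings. [this work] -/
theorem varTerms_equivariant : TriEquivariant varTerms := by
  intro n τ t
  obtain ⟨a, b, c⟩ := t
  rfl

/-- `K₃` check (base `2^14`). [this work] -/
theorem checkVar3 : checkC 3 14 (varTerms 3 (tri₀ 3 le_rfl)) = true := by native_decide

/-- `K₄` check (base `2^23`). [this work] -/
theorem checkVar4 : checkC 4 23 (varTerms 4 (tri₀ 4 (by norm_num))) = true := by native_decide

/-- `K₅` check (base `2^35`). [this work] -/
theorem checkVar5 : checkC 5 35 (varTerms 5 (tri₀ 5 (by norm_num))) = true := by native_decide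

/-- **`(3PT)` (term form) on every weighted graph with at most five vertices.** [this work] -/
theorem var_cval_le_five : ∀ n ≤ 5, ∀ (w : Sym2 (Fin n) → unitInterval) (a b c : Fin n),
    a ≠ b → a ≠ c → b ≠ c → 0 ≤ cval w (varTerms n (a, b, c)) :=
  tri_cval_le_five varTerms_equivariant checkVar3 checkVar4 checkVar5

/-! ## The two new predicates as connection events -/

section cells
variable (a b : Fin n)

/-- `a ↔ b` in `openConn` notation. [this work] -/
theorem connEvent_pAB : connEvent (pAB a b) = openConn a b := by
  ext ω
  simp only [connEvent, pAB, Set.mem_setOf_eq, decide_eq_true_eq]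
/-- `a ↮ b` in `openConn` notation. [this work] -/
theorem connEvent_pNAB : connEvent (pNAB a b) = (openConn a b)ᶜ := by
  ext ω
  simp only [connEvent, pNAB, Set.mem_setOf_eq, Set.mem_compl_iff, Bool.not_eq_true', decide_eq_false_iff_not]

end cells

/-- **The three-point variance row on every weighted graph with at most five vertices**: for `n ≤ 5`, every `w` and all pairwise distinct
`a b c : Fin n`,  `P(a↔b)·P(a↮b) ≤ P(a↔b, a↮c) + P(a↔c, a↮b) + P(b↔c, a↮b)`. [this work] -/
theorem threePointVariance_le_five (hn : n ≤ 5) (w : Sym2 (Fin n) → unitInterval) (a b c : Fin n) (hab : a ≠ b) (hac : a ≠ c)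
    (hbc : b ≠ c) :
    (prodBernoulli w).real (openConn a b) * (prodBernoulli w).real (openConn a b)ᶜ ≤
      (prodBernoulli w).real (openConn a b ∩ (openConn a c)ᶜ) + (prodBernoulli w).real (openConn a c ∩ (openConn a b)ᶜ) +
        (prodBernoulli w).real (openConn b c ∩ (openConn a b)ᶜ) := by
  have h := var_cval_le_five n hn w a b c hab hac hbc
  unfold varTerms cval at h
  simp only [List.map_cons, List.map_nil, List.sum_cons, List.sum_nil, pr_pTrue] at h
  unfold pr at h
  rw [connEvent_pU₁, connEvent_pU₂, connEvent_pU₃, connEvent_pAB, connEvent_pNAB] at h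
  push_cast at h
  linarith

end Summit.CriticalPhenomena.PercolationContinuityZ3.Theorems.ThreePointVariance
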